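import Literature.IUT.HodgeTheaters.PuncturedEllipticProLModelModL
import Literature.IUT.HodgeTheaters.PuncturedEllipticCoveringsEps0Ramification
import HarnessLib

/-!
# An infinite pro-`l` model of [IUTchI] §1, part 8: the zero cusp `ε⁰` is ramified in `X̲→ → X̲` (`h0`) at the datum

Mochizuki, *Inter-universal Teichmüller theory I*, kurims manuscript (May 2020), §1, Cor. 1.2 proof p. 39: "the
decomposition groups of `ε⁰`, `ε′`, `ε″` in `Π_X̲` may be recovered as the decomposition groups of cusps … whose image in
`Gal(X̲→/X̲) = Π_X̲/Π_{X̲→}` is nontrivial" ([IUTchI] Cor 1.2 p.39) [claim: Mochizuki2012, status: disputed] (D-0012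
claim key; series status DISPUTED — WITNESS-class PROOF-ONLY module; nothing of the series is asserted, no side is taken
on [IUTchIII] Cor. 3.12).  GAP-LEDGER row G-L5d4g6-1 (abc-iut-L5-d4 g6): the binder `h0 : ¬ D.inertia D.ε0 ≤ D.piXarrow`
of every Cor. 1.2 closer (p447384 … `…_of_geomOrigin`) is INDEPENDENT of the typed §1 record (abc-iut-L5-t1
p436203/p437242; abc-iut-L5-t7 p436395).

At the pro-`l` datum `ProLModel.datum l h5` of abc-iut-L5-d4 (parts 1–7) it HOLDS:
* `sup_inertia_zero_jKer_eq` — `I_{ε⁰} · Ker(Π_X̲ ↠ J_X) = Δ_X̲`: modulo `jKer` the module `N` is spanned by the inertia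
  lines `ℤ_l·c_x` (`x ≠ ±1`, from `I_{ε⁰}` and `Ker(Δ_X̲ ↠ Δ_ε)`) and the `ι`-SYMMETRIC vectors `w + σ_0 w = [(w), ι]`,
  which suffice because `2 ∈ ℤ_l^×` (`2c_1 = (c_1 − c_{−1}) + (c_1 + c_{−1})`, `2B_0 = (B_0 + B_1) − c_0`) and
  `a^{2s} = [a^s, ι]`;
* **`not_inertia_ε0_le_piXarrow_datum` — `h0`**: by abc-iut-L5-t7's reduction `ArrowCoveringClaims.not_inertia_ε0_le_piXarrow_of_sup`
  (p436395) from the printed claims at the datum (part 7's `arrowCoveringClaims_datum`).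
So the GAP binders `h0`, `h0′` are inhabited at the same infinite datum as `CuspGalois`, `ModLCuspLaws`, `[Δ_X:H] = l²`,
`GeomTFG`, `huniq′` (the `Δ_X̲`-abelian pro-`l` shadow).  HONEST LABEL: semi-synthetic model (`G_k = 1`) — consistency
evidence for OUR typed binders; no `sorry`; symbolic prime `l`.
-/

noncomputable section

namespace Literature.IUT.HodgeTheaters

namespace PuncturedEllipticData

namespace ProLModel

open DihedralGroup _root_.Topology Literature.AnabelianGeometry.AbsoluteAnabelian
open scoped Pointwise

variable (l : ℕ) [Fact l.Prime]

/-- `2 ∈ ℤ_l^×` for `l ≥ 5`: some `u` has `u + u = 1`. [folklore] -/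
private theorem exists_add_self_eq_one (h5 : 5 ≤ l) : ∃ u : ℤ_[l], u + u = 1 := by
  have h2 : (2 : ZMod l) ≠ 0 := (ArrowModel.cusp_facts_of_five_le l h5).2.2.2.1
  have hu : IsUnit (2 : ℤ_[l]) := by
    by_contra hn
    have hmem : (2 : ℤ_[l]) ∈ IsLocalRing.maximalIdeal ℤ_[l] := hn
    rw [← PadicInt.ker_toZMod, RingHom.mem_ker, map_ofNat] at hmem
    exact h2 hmem
  obtain ⟨u, hu⟩ := hu.exists_left_inv
  exact ⟨u, by rw [← two_mul, mul_comm, hu]⟩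

/-- `Σ_x c_x = 0` (the single relation among the inertia generators). [claim: Mochizuki2012, status: disputed] -/
theorem sum_cvec_eq_zero : ∑ x : ZMod l, cvec l x = 0 := by
  unfold cvec
  rw [Finset.sum_sub_distrib, sub_eq_zero]
  exact Fintype.sum_equiv (Equiv.addRight 1) _ _ fun x => rfl

/-- The involution `ι = (0, (0, ι)) ∈ Π_C`: it lies in `Π_C̲ = Δ_C̲`, not in `Π_X`, hence not in `Δ_X̲`.
[claim: Mochizuki2012, status: disputed] -/
theorem iota_mem_and_not_mem : (SemidirectProduct.inr (SemidirectProduct.inr (Multiplicative.ofAdd (1 : ZMod 2))) : P l)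
    ∈ PiCbarm l ∧ (SemidirectProduct.inr (SemidirectProduct.inr (Multiplicative.ofAdd (1 : ZMod 2))) : P l) ∉ PiXm l := by
  constructor
  · rw [mem_PiCbarm_iff]
    right
    rw [SemidirectProduct.right_inr, toDih_apply, SemidirectProduct.left_inr, SemidirectProduct.right_inr, toAdd_one,
      map_zero, r_zero, one_mul]
    have h1 : expo (Multiplicative.ofAdd (1 : ZMod 2)) = 1 := rfl
    rw [h1, pow_one]
  · rw [mem_PiXm_iff, SemidirectProduct.right_inr, SemidirectProduct.right_inr]
    intro h
    exact absurd (congrArg Multiplicative.toAdd h) (by rw [toAdd_ofAdd, toAdd_one]; exact one_ne_zero)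

/-- **`I_{ε⁰} · jKer = Δ_X̲` at the pro-`l` datum.** ([IUTchI] Cor 1.2 p.39) [claim: Mochizuki2012, status: disputed] -/
theorem sup_inertia_zero_jKer_eq (h5 : 5 ≤ l) :
    (datum l h5).inertia (datum l h5).ε0 ⊔ (datum l h5).jKer = (datum l h5).DeltaXbar := by
  classical
  obtain ⟨u, hu⟩ := exists_add_self_eq_one l h5
  obtain ⟨hιC, hιX⟩ := iota_mem_and_not_mem l
  set ι : P l := SemidirectProduct.inr (SemidirectProduct.inr (Multiplicative.ofAdd (1 : ZMod 2))) with hιdef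
  set T := (datum l h5).inertia (datum l h5).ε0 ⊔ (datum l h5).jKer with hT
  refine le_antisymm (sup_le ?_ (datum l h5).jKer_le_deltaXbar) ?_
  · rw [inertia_eq, deltaXbar_eq]; exact Dm_le_PiXbar l 0
  -- (1) inertia lines `ℤ_l·c_x` for `x ∉ {1, −1}`
  have hline : ∀ x : ZMod l, x ≠ 1 → x ≠ -1 → ∀ t : ℤ_[l], inN l (t • cvec l x) ∈ T := by
    intro x hx1 hx2 t
    have hmem : inN l (t • cvec l x) ∈ Dm l x := ⟨Multiplicative.ofAdd t, by rw [inertiaHom_apply, toAdd_ofAdd]⟩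
    by_cases hx0 : x = 0
    · subst hx0
      refine Subgroup.mem_sup_left ?_
      change inN l (t • cvec l 0) ∈ (datum l h5).inertia 0
      rw [inertia_eq]; exact hmem
    · refine Subgroup.mem_sup_right (Subgroup.mem_sup_left (Subgroup.mem_sup_right ?_))
      refine Subgroup.mem_iSup_of_mem ⟨x, hx0, hx1, hx2⟩ ?_
      change inN l (t • cvec l x) ∈ (datum l h5).inertia x
      rw [inertia_eq]; exact hmem
  -- (2) the `ι`-symmetric vectors `w − σ_0 w` are commutators `[(w), ι]`
  have hsym : ∀ w : V l, inN l (w - refl l 0 w) ∈ T := by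
    intro w
    refine Subgroup.mem_sup_right (Subgroup.mem_sup_right (Subgroup.subset_closure ?_))
    refine ⟨inN l w, ?_, ι, ?_, ?_, ?_⟩
    · rw [deltaXbar_eq]; exact inN_mem_PiXbar l w
    · rw [deltaCbar_eq]; exact hιC
    · rw [deltaXbar_eq]; exact fun h => hιX h.1
    · have h1 : ι * (inN l w)⁻¹ * ι⁻¹ = inN l (refl l 0 (-w)) := by
        rw [← inN_neg, conj_inN, toDih_right_of_mem_PiCbarm_not_PiXm l hιC hιX, dact_sr]
      have h2 : inN l w * ι * (inN l w)⁻¹ * ι⁻¹ = inN l w * (ι * (inN l w)⁻¹ * ι⁻¹) := by group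
      rw [h2, h1, ← inN_add, map_neg, sub_eq_add_neg]
  -- (3) the lines `c_1`, `c_{−1}`: `2c_{±1} = (c_1 + c_{−1}) ± (c_1 − c_{−1})`
  have h10 : (1 : ZMod l) ≠ 0 := (ArrowModel.cusp_facts_of_five_le l h5).1
  have h1m1 : (1 : ZMod l) ≠ -1 := (ArrowModel.cusp_facts_of_five_le l h5).2.2.1
  have hplus : ∀ t : ℤ_[l], inN l (t • (cvec l 1 + cvec l (-1))) ∈ T := by
    intro t
    have hsum : cvec l 1 + cvec l (-1) = -∑ x ∈ (Finset.univ.erase 1).erase (-1), cvec l x := by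
      rw [eq_neg_iff_add_eq_zero, ← sum_cvec_eq_zero l, ← Finset.add_sum_erase _ _ (Finset.mem_univ (1 : ZMod l)),
        ← Finset.add_sum_erase _ _ (Finset.mem_erase.2 ⟨Ne.symm h1m1, Finset.mem_univ (-1 : ZMod l)⟩), add_assoc]
    rw [hsum, smul_neg, inN_neg, Finset.smul_sum]
    refine T.inv_mem ?_
    refine Finset.sum_induction _ (fun v : V l => inN l v ∈ T) (fun a b ha hb => ?_) ?_ ?_
    · rw [inN_add]; exact T.mul_mem ha hb
    · rw [inN_zero]; exact T.one_mem
    · intro x hx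
      obtain ⟨hx2, hx⟩ := Finset.mem_erase.1 hx
      obtain ⟨hx1, -⟩ := Finset.mem_erase.1 hx
      exact hline x hx1 hx2 t
  have hminus : ∀ t : ℤ_[l], inN l (t • (cvec l 1 - cvec l (-1))) ∈ T := by
    intro t
    have : t • (cvec l 1 - cvec l (-1)) = t • cvec l 1 - refl l 0 (t • cvec l 1) := by
      rw [← dact_sr, dact_smul, dact_sr, refl_cvec, neg_zero, zero_sub, smul_sub]
    rw [this]; exact hsym _
  have hone : ∀ t : ℤ_[l], inN l (t • cvec l 1) ∈ T := by
    intro t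
    have : t • cvec l 1 = (u * t) • (cvec l 1 + cvec l (-1)) + (u * t) • (cvec l 1 - cvec l (-1)) := by
      rw [smul_add, smul_sub, add_add_sub_cancel, ← add_smul, ← add_mul, hu, one_mul]
    rw [this, inN_add]; exact T.mul_mem (hplus _) (hminus _)
  have hmone : ∀ t : ℤ_[l], inN l (t • cvec l (-1)) ∈ T := by
    intro t
    have : t • cvec l (-1) = (u * t) • (cvec l 1 + cvec l (-1)) - (u * t) • (cvec l 1 - cvec l (-1)) := by
      rw [smul_add, smul_sub, add_sub_sub_cancel, ← add_smul, ← add_mul, hu, one_mul]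
    rw [this, inN_sub]; exact T.mul_mem (hplus _) (T.inv_mem (hminus _))
  -- (4) all lines, hence every `(v)` corrected by its sum
  have hall : ∀ x : ZMod l, x ≠ 0 → ∀ t : ℤ_[l], inN l (t • cvec l x) ∈ T := by
    intro x _ t
    by_cases hx1 : x = 1
    · subst hx1; exact hone t
    by_cases hx2 : x = -1
    · subst hx2; exact hmone t
    exact hline x hx1 hx2 t
  -- (5) `(t·B_0) ∈ T`: `2B_0 = (B_0 − σ_0 B_0) − c_0`, with `B_0 − σ_0 B_0 = B_0 + B_1`
  have hB0 : ∀ t : ℤ_[l], inN l (t • δ l 0) ∈ T := by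
    intro t
    have hr : refl l 0 (δ l 0) = -δ l 1 := by
      funext m
      rw [refl_apply, Pi.neg_apply, δ_apply, δ_apply, sub_zero]
      by_cases hm : m = 1
      · rw [if_pos hm, if_pos (by rw [hm, sub_self])]
      · rw [if_neg hm, if_neg (fun h => hm (by rw [sub_eq_zero] at h; exact h.symm))]
    have hv : t • δ l 0 = (u * t) • (δ l 0 - refl l 0 (δ l 0)) - (u * t) • cvec l 0 := by
      rw [hr, cvec, zero_add, sub_neg_eq_add, smul_add, smul_sub]
      have e : (u * t) • δ l 0 + (u * t) • δ l 1 - ((u * t) • δ l 1 - (u * t) • δ l 0) = ((u * t) + (u * t)) • δ l 0 := by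
        rw [add_smul]; abel
      rw [e, ← add_mul, hu, one_mul]
    rw [hv, inN_sub, smul_sub, ← dact_sr, ← dact_smul, dact_sr]
    exact T.mul_mem (hsym _) (T.inv_mem (hline 0 h10.symm (fun h => h10 (by linear_combination h)) _))
  -- (6) `a^s ∈ T` for `s ≡ 0 (mod l)`: `a^{2s} = [a^s, ι]`
  have hA : ∀ s : ℤ_[l], PadicInt.toZMod s = 0 → elA l s ∈ T := by
    intro s hs
    have hs' : PadicInt.toZMod (u * s) = 0 := by rw [map_mul, hs, mul_zero]
    have hcomm : elA l (u * s) * ι * (elA l (u * s))⁻¹ * ι⁻¹ ∈ T := by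
      refine Subgroup.mem_sup_right (Subgroup.mem_sup_right (Subgroup.subset_closure ?_))
      refine ⟨elA l (u * s), ?_, ι, ?_, ?_, rfl⟩
      · rw [deltaXbar_eq]; exact elA_mem_PiXbar l hs'
      · rw [deltaCbar_eq]; exact hιC
      · rw [deltaXbar_eq]; exact fun h => hιX h.1
    have h1 : ι * (elA l (u * s))⁻¹ * ι⁻¹ = elA l (u * s) := by
      have hneg : (elA l (u * s))⁻¹ = elA l (-(u * s)) := by
        rw [eq_comm, eq_inv_iff_mul_eq_one, ← elA_add, neg_add_cancel]; unfold elA; rw [ofAdd_zero, map_one, map_one]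
      rw [hneg, conj_elA_of_not_mem_PiXm l hιX (by rw [map_neg, hs', neg_zero]), neg_neg]
    have h2 : elA l (u * s) * ι * (elA l (u * s))⁻¹ * ι⁻¹ = elA l (u * s) * (ι * (elA l (u * s))⁻¹ * ι⁻¹) := by group
    rw [h2, h1, ← elA_add, ← add_mul, hu, one_mul] at hcomm
    exact hcomm
  -- conclusion
  intro g hg
  rw [deltaXbar_eq] at hg
  obtain ⟨-, hs⟩ := (mem_PiXbar_iff l g).1 hg
  rw [decomp_of_mem_PiXm l hg.1]
  refine T.mul_mem ?_ (hA _ hs)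
  set v : V l := Multiplicative.toAdd g.left
  have hv : v = (v - (∑ m, v m) • δ l 0) + (∑ m, v m) • δ l 0 := (sub_add_cancel _ _).symm
  rw [hv, inN_add]
  exact T.mul_mem (inN_sub_sum_mem_of_cvec_mem l T hall v) (hB0 _)

/-- **`h0` at the pro-`l` datum: the zero cusp `ε⁰` is ramified in `X̲→ → X̲`** — `¬ I_{ε⁰} ≤ Π_{X̲→}` (literal shape of
the GAP binder `h0` / `h0′` of every Cor. 1.2 closer, G-L5d4g6-1), by abc-iut-L5-t7's reduction law BY NAME.
([IUTchI] Cor 1.2 p.39) [claim: Mochizuki2012, status: disputed] -/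
theorem not_inertia_ε0_le_piXarrow_datum (h5 : 5 ≤ l) :
    ¬ (datum l h5).inertia (datum l h5).ε0 ≤ (datum l h5).piXarrow :=
  (arrowCoveringClaims_datum l h5).not_inertia_ε0_le_piXarrow_of_sup (sup_inertia_zero_jKer_eq l h5)

/-- **Joint inhabitation at ONE infinite datum** (the census line for the Cor. 1.2 certificate's NV column): at
`ProLModel.datum l h5` — `CuspGalois`, `ModLCuspLaws`, `ArrowCoveringClaims`, `h0`, `[Δ_X : H] = l²` (`hrank`), `hIH`,
`GeomTFG` (`hΔ`) and the unique-double-cover law (`huniq`) hold together. ([IUTchI] §1 pp.37–39) [claim: Mochizuki2012, status: disputed] -/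
theorem exists_sectionOne_proL_model (h5 : 5 ≤ l) :
    ∃ D : PuncturedEllipticData.{0}, Nonempty D.CuspGalois ∧ D.ModLCuspLaws ∧ D.ArrowCoveringClaims ∧
      ¬ D.inertia D.ε0 ≤ D.piXarrow ∧ D.E.GeomTFG ∧
      (⁅D.PiX ⊓ D.DeltaC, D.PiX ⊓ D.DeltaC⁆ ⊔ Subgroup.closure ((fun y : D.PiC => y ^ D.l) ''
          (D.PiX ⊓ D.DeltaC : Set D.PiC))).topologicalClosure.relIndex (D.PiX ⊓ D.DeltaC) = D.l ^ 2 ∧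
      (∀ x : D.Cusp, D.inertia x ≤ (⁅D.PiX ⊓ D.DeltaC, D.PiX ⊓ D.DeltaC⁆ ⊔ Subgroup.closure ((fun y : D.PiC => y ^ D.l) ''
          (D.PiX ⊓ D.DeltaC : Set D.PiC))).topologicalClosure) ∧
      (∀ J ∈ AbsTopII.semiEllipticDoubleCoverSubgroups D.E, J ⊓ D.DeltaC = D.PiX ⊓ D.DeltaC) :=
  ⟨datum l h5, ⟨cuspGalois l h5⟩, modLCuspLaws_datum l h5, arrowCoveringClaims_datum l h5,
    not_inertia_ε0_le_piXarrow_datum l h5, geomTFG l h5, frattini_relIndex l h5, inertia_le_frattini l h5,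
    inf_deltaC_eq_of_mem_semiEllipticDoubleCoverSubgroups l h5⟩

end ProLModel

end PuncturedEllipticData

end Literature.IUT.HodgeTheaters
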